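import Mathlib
import HarnessLib

/-!
# The invariant region of Barbato–Morandin–Romito: the numerical inequalities
  (BMR 2011, Lemma 2.1, "a direct computation shows that both ψ₁ and ψ₂ are positive")

Barrier catalogue `Literature/Barriers/NavierStokesRegularity/`, proof file towards the named fact
`Dyadic.BarbatoMorandinRomito2011_thm1` (`DyadicCascadeRegularity`): the purely numerical content of
the invariant-region Lemma 2.1 of Barbato–Morandin–Romito 2011 (§2, pp. 4–5 of the held arXiv
text), isolated as inequalities between real numbers so that the dynamical argument
(`DyadicInvariantRegion.lean`) is free of numerics. The companion files `DyadicCascadePositivity`,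
`DyadicCascadeUniqueness` (positivity, energy, Prop. 3.2) are by a sibling effort; this file and its
sequels formalise §2 (Lemma 2.1) and the smoothing step of the proof of Thm. 1 (§3.2).

BMR fix `λ = 2`, `δ = 1/10`, `θ = 3/5`, `m = 3/4`, the exponent `γ = 6 - 2β - 3ε`, `c = λ^{-γ}`
(so that `λ^γ c = 1`), the region `A = {0 ≤ x ≤ 1, h(x) ≤ y ≤ g(x)}` with `g(x) = min {mx + θ, 1}`,
`h(x) = c ((x-δ)/(1-δ))^{λ²}` for `x > δ` and `0` for `x ≤ δ`, and reduce inward-pointing of the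
vector field on the two curved pieces of `∂A` to the positivity of
`ψ₁(x) = (mx+θ)((mx+θ-δ)/(1-δ))⁴ - x² - mx(mx+θ)` on `[0, (1-θ)/m]` and of
`ψ₂(x) = λ[x² - θu⁴] - m u⁸ - (1-δ)⁻¹u³[1 - xu⁴]`, `u = (x-δ)/(1-δ)`, on `[δ, 1]`, "for small `ε`"
by continuity, the positivity itself being read off a plot (Figure 2). Here:

* `top_slant_ineq` — `ψ₁ ≥ 0` on `[0, 8/15]` (`nlinarith` certificate). This is all the slanted
  piece `y = mx + θ` needs, for EVERY `ε ≥ 0` (our bookkeeping: `λ^{2-ε} ≥ λ^γ` already for `β ≥ 2`).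
* `bottom_poly_ge` — the `ε`-dependent lower bound of BMR (2.3) for the curved bottom piece
  `y = h(x)`, with `ε ∈ [0, 1/100]` absorbed into the rational bounds `2^{-ε} ≥ 0.993`,
  `2^{2ε} ≤ 1.015`, `2^{3ε} ≤ 1.022` (`rpow_two_neg_le`, …): the resulting degree-8 polynomial in
  `u ∈ [0, 1]` is `≥ 0.039`, certified by its Bernstein coefficients on `[0, 1]` (all positive; fed
  to `linarith` as the nine products `uᵏ(1-u)^{8-k} ≥ 0`). BMR's `ψ₂` is the case `ε = 0`, whose
  minimum `ψ₂(1) = 0.05` forces `ε < 0.031`; we take `ε ≤ 1/100`.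
* `bottom_curve_ineq` — the assembled inequality in the form consumed by the dynamical argument:
  for `x ∈ [δ, 1]`, `L ≥ 4·0.993`, `C ≤ 1.022/2`, `LC ≤ 2·1.015`,
  `L(x² - u⁴(mCu⁴ + θ)) - (4C/(1-δ)) u³ (1 - xu⁴) > 0` (here `L = λ^{2-ε}`, `C = c = λ^{-γ}`).
* the exponent bookkeeping `two_rpow_*`: for `2 ≤ β ≤ 5/2`, `0 ≤ ε ≤ 1/100` and `γ = 6-2β-3ε`:
  `λ^γ λ^{-γ} = 1`, `λ^{-γ} ≤ 1`, `λ^γ ≤ λ^{2-ε}`, `4·0.993 ≤ λ^{2-ε}`, `λ^{-γ} ≤ 1.022/2`,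
  `λ^{2-ε}λ^{-γ} ≤ 2·1.015`.

Theorem-only module (no definitions).

## References

* D. Barbato, F. Morandin, M. Romito, *Smooth solutions for the dyadic model*, Nonlinearity 24
  (2011) 3083–3097, §2 Lemma 2.1, (2.2)–(2.3) and the choice `δ = 1/10`, `θ = 3/5`, `m = 3/4`
  (arXiv:1007.3401, pp. 4–5). [`BarbatoMorandinRomito2011`]
-/

noncomputable section

open Real

namespace Literature.Barriers.NavierStokesRegularity.Dyadic

/-! ## Rational bounds for `2^{±ε}`, `ε ≤ 1/100` -/

/-- `2^{-1/100} ≥ 0.993` (since `0.993^{100} < 1/2`). [folklore] -/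
theorem rpow_two_neg_hundredth_ge : (0.993 : ℝ) ≤ (2 : ℝ) ^ (-(1 : ℝ) / 100) := by
  have h2 : ((2 : ℝ) ^ (-(1 : ℝ) / 100)) ^ (100 : ℕ) = 1 / 2 := by
    rw [← Real.rpow_natCast, ← Real.rpow_mul (by norm_num)]
    norm_num
  by_contra h
  push Not at h
  have h0 : (0 : ℝ) ≤ (2 : ℝ) ^ (-(1 : ℝ) / 100) := by positivity
  have h3 : ((2 : ℝ) ^ (-(1 : ℝ) / 100)) ^ (100 : ℕ) < (0.993 : ℝ) ^ (100 : ℕ) :=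
    pow_lt_pow_left₀ h h0 (by norm_num)
  rw [h2] at h3
  norm_num at h3

/-- `2^{2/100} ≤ 1.015` (since `1.015^{100} > 4`). [folklore] -/
theorem rpow_two_two_hundredth_le : (2 : ℝ) ^ ((2 : ℝ) / 100) ≤ 1.015 := by
  have h2 : ((2 : ℝ) ^ ((2 : ℝ) / 100)) ^ (100 : ℕ) = 4 := by
    rw [← Real.rpow_natCast, ← Real.rpow_mul (by norm_num)]
    norm_num
  by_contra h
  push Not at h
  have h3 : (1.015 : ℝ) ^ (100 : ℕ) < ((2 : ℝ) ^ ((2 : ℝ) / 100)) ^ (100 : ℕ) :=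
    pow_lt_pow_left₀ h (by norm_num) (by norm_num)
  rw [h2] at h3
  norm_num at h3

/-- `2^{3/100} ≤ 1.022` (since `1.022^{100} > 8`). [folklore] -/
theorem rpow_two_three_hundredth_le : (2 : ℝ) ^ ((3 : ℝ) / 100) ≤ 1.022 := by
  have h2 : ((2 : ℝ) ^ ((3 : ℝ) / 100)) ^ (100 : ℕ) = 8 := by
    rw [← Real.rpow_natCast, ← Real.rpow_mul (by norm_num)]
    norm_num
  by_contra h
  push Not at h
  have h3 : (1.022 : ℝ) ^ (100 : ℕ) < ((2 : ℝ) ^ ((3 : ℝ) / 100)) ^ (100 : ℕ) :=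
    pow_lt_pow_left₀ h (by norm_num) (by norm_num)
  rw [h2] at h3
  norm_num at h3

/-- For `ε ≤ 1/100`: `2^{-ε} ≥ 0.993`. [folklore] -/
theorem rpow_two_neg_ge {ε : ℝ} (hε1 : ε ≤ 1 / 100) : (0.993 : ℝ) ≤ (2 : ℝ) ^ (-ε) :=
  rpow_two_neg_hundredth_ge.trans
    (Real.rpow_le_rpow_of_exponent_le (by norm_num) (by linarith))

/-- For `0 ≤ ε ≤ 1/100`: `2^{2ε} ≤ 1.015`. [folklore] -/
theorem rpow_two_two_mul_le {ε : ℝ} (hε1 : ε ≤ 1 / 100) : (2 : ℝ) ^ (2 * ε) ≤ 1.015 :=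
  (Real.rpow_le_rpow_of_exponent_le (by norm_num) (by linarith)).trans rpow_two_two_hundredth_le

/-- For `0 ≤ ε ≤ 1/100`: `2^{3ε} ≤ 1.022`. [folklore] -/
theorem rpow_two_three_mul_le {ε : ℝ} (hε1 : ε ≤ 1 / 100) : (2 : ℝ) ^ (3 * ε) ≤ 1.022 :=
  (Real.rpow_le_rpow_of_exponent_le (by norm_num) (by linarith)).trans rpow_two_three_hundredth_le

/-! ## The exponents of Lemma 2.1: `γ = 6 - 2β - 3ε`, `c = 2^{-γ}`, `λ^γ c = 1` -/

/-- `2^γ · 2^{-γ} = 1` ("the term … is positive if we choose `λ^γ c = 1`"). [cite: BarbatoMorandinRomito2011, §2 Lemma 2.1 (proof)] -/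
theorem two_rpow_mul_two_rpow_neg (γ : ℝ) : (2 : ℝ) ^ γ * (2 : ℝ) ^ (-γ) = 1 := by
  rw [Real.rpow_neg (by norm_num), mul_inv_cancel₀ (Real.rpow_pos_of_pos (by norm_num) γ).ne']

/-- `c = 2^{-γ} ≤ 1` for `β ≤ 5/2`, `ε ≤ 1/100` (i.e. `γ ≥ 0`), so that `h ≤ g` on `[0, 1]`.
[cite: BarbatoMorandinRomito2011, §2 Lemma 2.1 (proof)] -/
theorem two_rpow_neg_gamma_le_one {β ε : ℝ} (hβ : β ≤ 5 / 2) (hε : ε ≤ 1 / 100) :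
    (2 : ℝ) ^ (-(6 - 2 * β - 3 * ε)) ≤ 1 :=
  Real.rpow_le_one_of_one_le_of_nonpos (by norm_num) (by linarith)

/-- `λ^γ ≤ λ^{2-ε}` as soon as `β ≥ 2 - ε` (BMR use `γ ≤ 2 - 3ε`, i.e. `β ≥ 2`): the coefficient
of the transport term never exceeds that of the production term one shell up.
[cite: BarbatoMorandinRomito2011, §2 Lemma 2.1 (proof, before (2.2))] -/
theorem two_rpow_gamma_le {β ε : ℝ} (hβ : 2 ≤ β) (hε : 0 ≤ ε) :
    (2 : ℝ) ^ (6 - 2 * β - 3 * ε) ≤ (2 : ℝ) ^ (2 - ε) :=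
  Real.rpow_le_rpow_of_exponent_le (by norm_num) (by linarith)

/-- `λ^{2-ε} ≥ 4 · 0.993` for `ε ≤ 1/100`. [folklore] -/
theorem two_rpow_two_sub_ge {ε : ℝ} (hε : ε ≤ 1 / 100) : 4 * (0.993 : ℝ) ≤ (2 : ℝ) ^ (2 - ε) := by
  have h : (2 : ℝ) ^ (2 - ε) = 4 * (2 : ℝ) ^ (-ε) := by
    rw [sub_eq_add_neg, Real.rpow_add (by norm_num)]; norm_num
  rw [h]
  exact mul_le_mul_of_nonneg_left (rpow_two_neg_ge hε) (by norm_num)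

/-- `λ^{2-ε} ≤ 4` for `ε ≥ 0`. [folklore] -/
theorem two_rpow_two_sub_le {ε : ℝ} (hε : 0 ≤ ε) : (2 : ℝ) ^ (2 - ε) ≤ 4 := by
  have h : (2 : ℝ) ^ (2 - ε) ≤ (2 : ℝ) ^ (2 : ℝ) :=
    Real.rpow_le_rpow_of_exponent_le (by norm_num) (by linarith)
  have h4 : (2 : ℝ) ^ (2 : ℝ) = 4 := by norm_num
  linarith

/-- `c = 2^{-γ} ≤ 2^{3ε-1} ≤ 1.022/2` for `β ≤ 5/2`, `0 ≤ ε ≤ 1/100` (BMR: "`γ ≥ 1 - 3ε`, hence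
`λ^{-γ} ≤ λ^{3ε-1}`" — the only place where `β ≤ 5/2` enters). [cite: BarbatoMorandinRomito2011, §2 Lemma 2.1 (proof, before (2.3))] -/
theorem two_rpow_neg_gamma_le {β ε : ℝ} (hβ : β ≤ 5 / 2) (hε : ε ≤ 1 / 100) :
    (2 : ℝ) ^ (-(6 - 2 * β - 3 * ε)) ≤ 1.022 / 2 := by
  calc (2 : ℝ) ^ (-(6 - 2 * β - 3 * ε)) ≤ (2 : ℝ) ^ (3 * ε + (-1)) :=
        Real.rpow_le_rpow_of_exponent_le (by norm_num) (by linarith)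
    _ = (2 : ℝ) ^ (3 * ε) * (1 / 2) := by rw [Real.rpow_add (by norm_num)]; norm_num
    _ ≤ 1.022 * (1 / 2) := mul_le_mul_of_nonneg_right (rpow_two_three_mul_le hε) (by norm_num)
    _ = 1.022 / 2 := by ring

/-- `λ^{2-ε} c = 2^{2β-4+2ε} ≤ 2^{1+2ε} ≤ 2 · 1.015` for `β ≤ 5/2`, `ε ≤ 1/100`.
[cite: BarbatoMorandinRomito2011, §2 Lemma 2.1 (proof, (2.3))] -/
theorem two_rpow_two_sub_mul_neg_gamma_le {β ε : ℝ} (hβ : β ≤ 5 / 2) (hε : ε ≤ 1 / 100) :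
    (2 : ℝ) ^ (2 - ε) * (2 : ℝ) ^ (-(6 - 2 * β - 3 * ε)) ≤ 2 * 1.015 := by
  rw [← Real.rpow_add (by norm_num)]
  calc (2 : ℝ) ^ (2 - ε + -(6 - 2 * β - 3 * ε)) ≤ (2 : ℝ) ^ ((1 : ℝ) + 2 * ε) :=
        Real.rpow_le_rpow_of_exponent_le (by norm_num) (by linarith)
    _ = 2 * (2 : ℝ) ^ (2 * ε) := by rw [Real.rpow_add (by norm_num), Real.rpow_one]
    _ ≤ 2 * 1.015 := mul_le_mul_of_nonneg_left (rpow_two_two_mul_le hε) (by norm_num)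

/-- Positivity of the coefficients. [folklore] -/
theorem two_rpow_pos (s : ℝ) : 0 < (2 : ℝ) ^ s := Real.rpow_pos_of_pos (by norm_num) s

/-! ## `ψ₁ ≥ 0`: the slanted piece `y = mx + θ` of the boundary -/

/-- **`ψ₁ ≥ 0` on `[0, (1-θ)/m] = [0, 8/15]`** (BMR (2.2) with `ε = 0`; `δ = 1/10`, `θ = 3/5`,
`m = 3/4`, `λ² = 4`), in the form `x² + m x y ≤ y ((y-δ)/(1-δ))⁴` with `y = mx + θ ≤ 1`:
the production of the upper shell dominates. Certified by `nlinarith`.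
[cite: BarbatoMorandinRomito2011, §2 Lemma 2.1 (2.2) and Fig. 2] -/
theorem top_slant_ineq {x y : ℝ} (hx : 0 ≤ x) (hy : y = 3 / 4 * x + 3 / 5) (hy1 : y ≤ 1) :
    x ^ 2 + 3 / 4 * x * y ≤ y * ((y - 1 / 10) / (9 / 10)) ^ 4 := by
  subst hy
  have hx1 : x ≤ 8 / 15 := by linarith
  have key : 0 ≤ (3 * x / 4 + 3 / 5) * ((15 * x + 10) / 18) ^ 4 - 25 * x ^ 2 / 16 - 9 * x / 20 := by
    nlinarith [mul_nonneg hx (sub_nonneg.2 hx1), sq_nonneg x, sq_nonneg (x - 1 / 6),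
      mul_nonneg (mul_nonneg hx hx) hx, mul_nonneg (mul_nonneg hx hx) (sub_nonneg.2 hx1),
      pow_nonneg hx 4, mul_nonneg (pow_nonneg hx 4) (sub_nonneg.2 hx1)]
  have h18 : (3 / 4 * x + 3 / 5 - 1 / 10) / (9 / 10) = (15 * x + 10) / 18 := by ring
  rw [h18]
  nlinarith [key]

/-! ## `ψ₂ > 0`: the curved bottom piece `y = h(x)` of the boundary -/

/-- **The bottom polynomial is bounded below by `0.039` on `[0, 1]`.** With `x = δ + (1-δ)u`,
`r₁ = 0.993 ≤ 2^{-ε}`, `r₂ = 1.015 ≥ 2^{2ε}`, `r₃ = 1.022 ≥ 2^{3ε}`, the lower bound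
`4r₁(x² - θu⁴) - (3/2) r₂ u⁸ - (20/9) r₃ u³ (1 - xu⁴)` of BMR's (2.3) (their `ψ₂` is the case
`r₁ = r₂ = r₃ = 1`, up to the factor `λ = 2`) expands to the degree-8 polynomial below, whose
Bernstein coefficients on `[0, 1]` are `≥ 0.0397`; `linarith` finds the certificate from the nine
basis products `uᵏ(1-u)^{8-k} ≥ 0`. [cite: BarbatoMorandinRomito2011, §2 Lemma 2.1 (2.3) and Fig. 2] -/
theorem bottom_poly_ge {u : ℝ} (hu0 : 0 ≤ u) (hu1 : u ≤ 1) :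
    (0.039 : ℝ) ≤ 993 / 25000 + 8937 / 12500 * u + 80433 / 25000 * u ^ 2 - 511 / 225 * u ^ 3 -
      2979 / 1250 * u ^ 4 + 511 / 2250 * u ^ 7 + 1043 / 2000 * u ^ 8 := by
  have h1u : 0 ≤ 1 - u := by linarith
  linarith [pow_nonneg h1u 8, mul_nonneg hu0 (pow_nonneg h1u 7),
    mul_nonneg (pow_nonneg hu0 2) (pow_nonneg h1u 6), mul_nonneg (pow_nonneg hu0 3) (pow_nonneg h1u 5),
    mul_nonneg (pow_nonneg hu0 4) (pow_nonneg h1u 4), mul_nonneg (pow_nonneg hu0 5) (pow_nonneg h1u 3),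
    mul_nonneg (pow_nonneg hu0 6) (pow_nonneg h1u 2), mul_nonneg (pow_nonneg hu0 7) h1u,
    pow_nonneg hu0 8]

/-- The bottom polynomial in the variables of BMR (2.3): for `u ∈ [0, 1]` and `x = 1/10 + (9/10)u`,
`4·0.993 (x² - (3/5)u⁴) - (3/2)·1.015 u⁸ - (20/9)·1.022 u³ (1 - xu⁴) ≥ 0.039`.
[cite: BarbatoMorandinRomito2011, §2 Lemma 2.1 (2.3)] -/
theorem bottom_bound_ge {u x : ℝ} (hu0 : 0 ≤ u) (hu1 : u ≤ 1) (hx : x = 1 / 10 + 9 / 10 * u) :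
    (0.039 : ℝ) ≤ 4 * 0.993 * (x ^ 2 - 3 / 5 * u ^ 4) - 3 / 2 * 1.015 * u ^ 8 -
      20 / 9 * 1.022 * u ^ 3 * (1 - x * u ^ 4) := by
  have h := bottom_poly_ge hu0 hu1
  subst hx
  have : 4 * 0.993 * ((1 / 10 + 9 / 10 * u) ^ 2 - 3 / 5 * u ^ 4) - 3 / 2 * 1.015 * u ^ 8 -
      20 / 9 * 1.022 * u ^ 3 * (1 - (1 / 10 + 9 / 10 * u) * u ^ 4) =
      993 / 25000 + 8937 / 12500 * u + 80433 / 25000 * u ^ 2 - 511 / 225 * u ^ 3 -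
      2979 / 1250 * u ^ 4 + 511 / 2250 * u ^ 7 + 1043 / 2000 * u ^ 8 := by ring
  linarith

/-- **The bottom-piece inequality in the form used by the dynamical argument.** For
`x ∈ [δ, 1] = [1/10, 1]`, `u = (x - δ)/(1 - δ)`, and coefficients `L` (`= λ^{2-ε}`), `C` (`= c`)
with `L ≥ 4·0.993`, `C ≤ 1.022/2`, `LC ≤ 2·1.015`:
`L (x² - u⁴ (m C u⁴ + θ)) - (4C/(1-δ)) u³ (1 - xu⁴) > 0`. This is BMR's chain (2.3):
`𝔅ᵢ·n₅ ≥ λ^{2-ε}(x² - λ^γ h(x) g(h(x))) - h'(x)(1 - λ^γ x h(x)) ≥ … ≥ ψ₂-type bound > 0`, with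
`h(x) = C u⁴`, `g(y) ≤ my + θ`, `λ^γ C = 1`, `h'(x) = 4C u³/(1-δ)`.
[cite: BarbatoMorandinRomito2011, §2 Lemma 2.1 (2.3)] -/
theorem bottom_curve_ineq {x L C : ℝ} (hx0 : 1 / 10 ≤ x) (hx1 : x ≤ 1) (hL : 4 * 0.993 ≤ L)
    (hC1 : C ≤ 1.022 / 2) (hLC : L * C ≤ 2 * 1.015) :
    0 < L * (x ^ 2 - ((x - 1 / 10) / (9 / 10)) ^ 4 * (3 / 4 * C * ((x - 1 / 10) / (9 / 10)) ^ 4 + 3 / 5)) -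
      4 * C / (9 / 10) * ((x - 1 / 10) / (9 / 10)) ^ 3 * (1 - x * ((x - 1 / 10) / (9 / 10)) ^ 4) := by
  set u : ℝ := (x - 1 / 10) / (9 / 10) with hu
  have hxu : x = 1 / 10 + 9 / 10 * u := by rw [hu]; ring
  have hu0 : 0 ≤ u := by rw [hu]; apply div_nonneg <;> linarith
  have hu1 : u ≤ 1 := by rw [hu, div_le_one (by norm_num)]; linarith
  have hux : u ≤ x := by linarith
  have hu4 : u ^ 4 ≤ 1 := pow_le_one₀ hu0 hu1
  have hu4x : u ^ 4 ≤ x ^ 2 := by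
    have h1 : u ^ 4 ≤ u ^ 2 := by nlinarith [pow_nonneg hu0 2, mul_le_one₀ hu1 hu0 hu1]
    have h2 : u ^ 2 ≤ x ^ 2 := pow_le_pow_left₀ hu0 hux 2
    linarith
  have hA : 0 ≤ x ^ 2 - 3 / 5 * u ^ 4 := by nlinarith [sq_nonneg x]
  have hB : 0 ≤ 1 - x * u ^ 4 := by nlinarith [pow_nonneg hu0 4]
  have hu3 : 0 ≤ u ^ 3 := pow_nonneg hu0 3
  have hu8 : 0 ≤ u ^ 8 := pow_nonneg hu0 8
  have key := bottom_bound_ge hu0 hu1 hxu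
  -- monotone replacement of the three coefficients
  have e1 : 4 * 0.993 * (x ^ 2 - 3 / 5 * u ^ 4) ≤ L * (x ^ 2 - 3 / 5 * u ^ 4) :=
    mul_le_mul_of_nonneg_right hL hA
  have e2 : L * (3 / 4 * C) * u ^ 8 ≤ 3 / 2 * 1.015 * u ^ 8 := by
    apply mul_le_mul_of_nonneg_right _ hu8
    linarith
  have e3 : 4 * C / (9 / 10) * u ^ 3 * (1 - x * u ^ 4) ≤ 20 / 9 * 1.022 * u ^ 3 * (1 - x * u ^ 4) := by
    have : 4 * C / (9 / 10) ≤ 20 / 9 * 1.022 := by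
      rw [div_le_iff₀ (by norm_num)]; linarith
    exact mul_le_mul_of_nonneg_right (mul_le_mul_of_nonneg_right this hu3) hB
  have expand : L * (x ^ 2 - u ^ 4 * (3 / 4 * C * u ^ 4 + 3 / 5)) =
      L * (x ^ 2 - 3 / 5 * u ^ 4) - L * (3 / 4 * C) * u ^ 8 := by ring
  rw [expand]
  linarith

/-! ## Elementary facts about the region functions `h`, `g` on `[0, 1]` -/

/-- For `x ≤ 1`: `(x - δ)/(1 - δ) ≤ x`. [folklore] -/
theorem sub_delta_div_le {x : ℝ} (hx1 : x ≤ 1) : (x - 1 / 10) / (9 / 10) ≤ x := by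
  rw [div_le_iff₀ (by norm_num)]; linarith

/-- For `x ∈ [δ, 1]`: `0 ≤ (x - δ)/(1 - δ) ≤ 1`. [folklore] -/
theorem sub_delta_div_mem {x : ℝ} (hx0 : 1 / 10 ≤ x) (hx1 : x ≤ 1) :
    0 ≤ (x - 1 / 10) / (9 / 10) ∧ (x - 1 / 10) / (9 / 10) ≤ 1 := by
  constructor
  · apply div_nonneg <;> linarith
  · rw [div_le_one (by norm_num)]; linarith

/-- The lower curve lies below the diagonal: for `C ≤ 1` and `x ∈ [δ, 1]`,
`C ((x-δ)/(1-δ))⁴ ≤ x` (so that the diagonal pair `(Y_N, Y_{N+1}) = (Y_N, Y_N)` of the truncation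
satisfies the lower constraint). [cite: BarbatoMorandinRomito2011, §2 (e:YNeq) and Lemma 2.1] -/
theorem lower_curve_le_self {C x : ℝ} (hC1 : C ≤ 1) (hx0 : 1 / 10 ≤ x) (hx1 : x ≤ 1) :
    C * ((x - 1 / 10) / (9 / 10)) ^ 4 ≤ x := by
  obtain ⟨hu0, hu1⟩ := sub_delta_div_mem hx0 hx1
  have hux := sub_delta_div_le hx1
  set u := (x - 1 / 10) / (9 / 10)
  have h1 : u ^ 4 ≤ u := by
    have : u ^ 4 ≤ u ^ 1 := pow_le_pow_of_le_one hu0 hu1 (by norm_num)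
    simpa using this
  calc C * u ^ 4 ≤ 1 * u := mul_le_mul hC1 h1 (pow_nonneg hu0 4) zero_le_one
    _ ≤ x := by linarith

/-- The diagonal lies below the upper line: for `y ≤ 1`, `y ≤ m y + θ`. [folklore] -/
theorem self_le_upper_line {y : ℝ} (hy1 : y ≤ 1) : y ≤ 3 / 4 * y + 3 / 5 := by linarith

end Literature.Barriers.NavierStokesRegularity.Dyadic
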